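import Summits.RiemannHypothesis.RiemannHypothesis.Theorems.PfPersistenceFloorRate
import Summits.RiemannHypothesis.RiemannHypothesis.Theorems.PfPersistenceFloorRateOdd
import Summits.RiemannHypothesis.RiemannHypothesis.Theorems.PfPersistenceGalerkinTestDensity
import HarnessLib

/-!
# PF persistence campaign (cell `pub-rhpf`, seat cand-7, gen 7): the FLOOR-RATE DICTIONARY, part 2 —
RH at rate zero, exponential sinking off RH, the dichotomy, and the parity-free energy

Mechanism/rigidity campaign; **no RH claims**.  Everything here is PROVED (Mathlib + tree theorems;
no named fact), from part 1 (`PfPersistenceFloorRate.lean`: an even floor `-K e^{δa} ≤ ε_ev(a)`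
for `a ≥ a₀`, `δ ≥ 0`, bounds every non-trivial zero by `|Re ρ - 1/2| ≤ δ/2`).

* `δ = 0`: **`ε_ev` bounded below on large windows ⇒ RH**
  (`riemannHypothesis_of_weilEvenGroundEnergy_bddBelow`, `riemannHypothesis_iff_weilEvenGroundEnergy_bddBelow`);
  sub-exponential floors at every rate ⟺ RH (`riemannHypothesis_iff_weilEvenGroundEnergy_subexp`).
* The campaign's ¬RH picture, PROVED: a zero at offset `β₀ = |Re ρ₀ - 1/2| > 0` forces
  `ε_ev(a) < -K e^{δa}` on arbitrarily large windows for EVERY `0 ≤ δ < 2β₀` and every `K`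
  (`weilEvenGroundEnergy_sinks_of_offline_zero`, `exists_rate_of_not_riemannHypothesis`), and the
  DICHOTOMY `weilEvenGroundEnergy_dichotomy`: either `ε_ev ≥ 0` on every window, or `ε_ev → -∞`
  (no regime "negative but bounded").
* The parity-free energy `ε = weilGroundEnergy ≤ ε_ev` inherits the dictionary
  (`abs_re_sub_half_le_of_floor`, `quasiRiemannHypothesis_of_floor`,
  `weilGroundEnergy_sinks_of_offline_zero`, `abs_re_sub_half_le_of_parity_floors`), SHARPENING the
  tree's `GroundStatesConvergeToXi.abs_re_sub_half_le_of_weilGroundEnergy_ge_neg_exp` (`≤ δ`) to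
  `≤ δ/2`: under a zero of offset `β₀` the data reader of `lg(-ε(a))` should see slope `≥ 2β₀`
  (natural-log rate), not `β₀`.
* The ODD thermometer (§10, from `PfPersistenceFloorRateOdd.lean`): RH ⟺ `ε_od` bounded below on
  `a > 0` ⟺ sub-exponential (`riemannHypothesis_iff_weilOddGroundEnergy_bddBelow`, `…_subexp`; the
  tree's `OddSector….riemannHypothesis_iff_forall_weilOddGroundEnergy_nonneg` asks `ε_od ≥ 0`),
  sinking off RH at every rate `< 2β₀` (`weilOddGroundEnergy_sinks_of_offline_zero`), dichotomy
  `weilOddGroundEnergy_dichotomy`.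
* The SERVED objects (§9): via the cell's PROVED Galerkin dictionary (`PfPersistence.galerkinFloorAt_iff`,
  cand-3) a rate floor `-K e^{δa}·‖v‖² ≤ ⟨v, B^{ev}_{a,N} v⟩` on `ζ`'s even Galerkin blocks at all
  half-lengths `a ≥ a₀` and ALL truncations `N` gives `|Re ρ - 1/2| ≤ δ/2`
  (`abs_re_sub_half_le_of_galerkinRateFloor`); a UNIFORM floor `-σ` (fixed `σ`, not `σ_k → 0` as in
  the tree's `riemannHypothesis_of_galerkinFloorSeq`) is already RH
  (`riemannHypothesis_of_galerkinFloor_uniform`, `riemannHypothesis_iff_galerkinFloor_uniform`), and off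
  RH every uniform floor is breached at arbitrarily large windows by some truncation
  (`exists_galerkin_breach_of_not_riemannHypothesis`).  No claim that `ζ` has any floor.

References: E. Bombieri, *Remarks on Weil's quadratic functional in the theory of prime numbers I*,
Rend. Lincei (9) 11 (2000) 183–233, §3 Thm. 1, §4 Thm. 5; H. Yoshida, *On Hermitian forms attached
to zeta functions*, Adv. Stud. Pure Math. 21 (1992), Prop. 1.
-/

set_option linter.dupNamespace false

noncomputable section

open Complex MeasureTheory Filter Set Matrix
open scoped Real Topology ComplexConjugate

namespace Summit.RiemannHypothesis.RiemannHypothesis.Theorems.PfPersistenceFloorRateDichotomy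

open Literature.NumberTheory.LFunctions
open Summit.RiemannHypothesis.RiemannHypothesis.Theorems.PfPersistenceFloorRate
open Summit.RiemannHypothesis.RiemannHypothesis.Theorems.PfPersistenceFloorRateOdd

/-! ## §6 Rate zero and sub-exponential floors: RH -/

/-- **`ε_ev` bounded below on large windows ⇒ RH** (the case `δ = 0`). [folklore] -/
theorem riemannHypothesis_of_weilEvenGroundEnergy_bddBelow {L a₀ : ℝ}
    (hL : ∀ a : ℝ, a₀ ≤ a → L ≤ weilEvenGroundEnergy a) : RiemannHypothesis := by
  have hL' : ∀ a : ℝ, a₀ ≤ a → -(-L * Real.exp (0 * a)) ≤ weilEvenGroundEnergy a := fun a ha ↦ by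
    simpa using hL a ha
  refine riemannHypothesis_iff_strip_holds.2 fun s hs h0 h1 ↦ ?_
  have h := abs_re_sub_half_le_of_even_floor_eventually le_rfl hL'
    (ZetaZeros.riemannZetaNontrivialZeros.mem_iff'.2 ⟨hs, h0, h1⟩)
  rw [zero_div, abs_nonpos_iff] at h
  linarith

/-- Under RH every even ground energy is `≥ 0` (Weil positivity under RH via the proved explicit
formula, `ε(a) ≥ 0 ⇒ ε_ev(a) ≥ ε(a)`; the junk value `0` for `a ≤ 0`). [folklore] -/
theorem weilEvenGroundEnergy_nonneg_of_riemannHypothesis' (hRH : RiemannHypothesis) (a : ℝ) :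
    0 ≤ weilEvenGroundEnergy a := by
  rcases le_or_gt a 0 with ha | ha
  · rw [weilEvenGroundEnergy_of_nonpos ha]
  · exact ((weilGroundEnergy_nonneg_iff_holds ha).2
      (WeilPositivityOn.of_riemannHypothesis explicit_formula_holds hRH a)).trans
      (weilGroundEnergy_le_weilEvenGroundEnergy a)

/-- **RH ⟺ `ε_ev` is bounded below on `a > 0`.** [folklore] -/
theorem riemannHypothesis_iff_weilEvenGroundEnergy_bddBelow :
    RiemannHypothesis ↔ ∃ L : ℝ, ∀ a : ℝ, 0 < a → L ≤ weilEvenGroundEnergy a := by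
  refine ⟨fun hRH ↦ ⟨0, fun a _ ↦ weilEvenGroundEnergy_nonneg_of_riemannHypothesis' hRH a⟩,
    fun ⟨L, hL⟩ ↦ ?_⟩
  exact riemannHypothesis_of_weilEvenGroundEnergy_bddBelow (a₀ := 1)
    fun a ha ↦ hL a (lt_of_lt_of_le one_pos ha)

/-- **Sub-exponential even floors ⇒ RH**: if for every rate `δ > 0` there are `K, a₀` with
`-K e^{δa} ≤ ε_ev(a)` for `a ≥ a₀`, then every non-trivial zero has `|Re ρ - 1/2| ≤ δ/2` for all
`δ > 0`, hence lies on the line. [folklore] -/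
theorem riemannHypothesis_of_weilEvenGroundEnergy_subexp
    (h : ∀ δ : ℝ, 0 < δ → ∃ K a₀ : ℝ, ∀ a : ℝ, a₀ ≤ a →
      -(K * Real.exp (δ * a)) ≤ weilEvenGroundEnergy a) :
    RiemannHypothesis := by
  refine riemannHypothesis_iff_strip_holds.2 fun s hs h0 h1 ↦ ?_
  have hρ := ZetaZeros.riemannZetaNontrivialZeros.mem_iff'.2 ⟨hs, h0, h1⟩
  have hall : ∀ δ : ℝ, 0 < δ → |s.re - 1 / 2| ≤ δ / 2 := fun δ hδ ↦ by
    obtain ⟨K, a₀, hK⟩ := h δ hδ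
    exact abs_re_sub_half_le_of_even_floor_eventually hδ.le hK hρ
  have h0' : |s.re - 1 / 2| ≤ 0 := le_of_forall_pos_le_add fun δ hδ ↦ by
    have := hall δ hδ
    linarith
  have := abs_nonpos_iff.1 h0'
  linarith

/-- **RH ⟺ the even ground energy is sub-exponential.** [folklore] -/
theorem riemannHypothesis_iff_weilEvenGroundEnergy_subexp :
    RiemannHypothesis ↔ ∀ δ : ℝ, 0 < δ → ∃ K a₀ : ℝ, ∀ a : ℝ, a₀ ≤ a →
      -(K * Real.exp (δ * a)) ≤ weilEvenGroundEnergy a := by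
  refine ⟨fun hRH δ _ ↦ ⟨0, 0, fun a _ ↦ ?_⟩, riemannHypothesis_of_weilEvenGroundEnergy_subexp⟩
  simpa using weilEvenGroundEnergy_nonneg_of_riemannHypothesis' hRH a

/-! ## §7 The ¬RH picture: exponential sinking and the dichotomy -/

/-- **Exponential sinking under an off-line zero.**  If some non-trivial zero has offset
`|Re ρ - 1/2| > δ/2` (`δ ≥ 0`), then for every `K` and `a₀` some window `a ≥ a₀` has
`ε_ev(a) < -K e^{δa}`: the even thermometer sinks at every exponential rate `< 2 |Re ρ - 1/2|`.
[folklore] -/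
theorem weilEvenGroundEnergy_sinks_of_offline_zero {ρ : ℂ}
    (hρ : ρ ∈ ZetaZeros.riemannZetaNontrivialZeros) {δ : ℝ} (hδ : 0 ≤ δ)
    (hδρ : δ / 2 < |ρ.re - 1 / 2|) (K a₀ : ℝ) :
    ∃ a : ℝ, a₀ ≤ a ∧ weilEvenGroundEnergy a < -(K * Real.exp (δ * a)) := by
  by_contra h
  push Not at h
  exact not_lt.2 (abs_re_sub_half_le_of_even_floor_eventually hδ h hρ) hδρ

/-- **If RH fails, the even thermometer sinks exponentially**: there is `β > 0` (the offset of an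
off-line zero) such that for every rate `0 ≤ δ < 2β`, every `K` and every `a₀` some window `a ≥ a₀`
has `ε_ev(a) < -K e^{δa}`. [folklore] -/
theorem exists_rate_of_not_riemannHypothesis (hRH : ¬ RiemannHypothesis) :
    ∃ β : ℝ, 0 < β ∧ ∀ δ : ℝ, 0 ≤ δ → δ < 2 * β → ∀ K a₀ : ℝ,
      ∃ a : ℝ, a₀ ≤ a ∧ weilEvenGroundEnergy a < -(K * Real.exp (δ * a)) := by
  have h : ¬ RiemannHypothesisStrip := fun hS ↦ hRH (riemannHypothesis_iff_strip_holds.2 hS)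
  unfold RiemannHypothesisStrip at h
  push Not at h
  obtain ⟨s, hs, h0, h1, hne⟩ := h
  refine ⟨|s.re - 1 / 2|, abs_pos.2 (sub_ne_zero.2 hne), fun δ hδ hδβ K a₀ ↦ ?_⟩
  exact weilEvenGroundEnergy_sinks_of_offline_zero
    (ZetaZeros.riemannZetaNontrivialZeros.mem_iff'.2 ⟨hs, h0, h1⟩) hδ (by linarith) K a₀

/-- **DICHOTOMY for the even thermometer**: either `ε_ev(a) ≥ 0` on every window (⟺ RH), or
`ε_ev(a) → -∞` as `a → ∞` (`ε_ev` is non-increasing on `(0,∞)` and, off RH, not bounded below on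
large windows).  There is no intermediate regime "negative but bounded". [folklore] -/
theorem weilEvenGroundEnergy_dichotomy :
    (∀ a : ℝ, 0 ≤ weilEvenGroundEnergy a) ∨ Tendsto weilEvenGroundEnergy atTop atBot := by
  by_cases hRH : RiemannHypothesis
  · exact Or.inl (weilEvenGroundEnergy_nonneg_of_riemannHypothesis' hRH)
  · refine Or.inr (tendsto_atBot.2 fun L ↦ ?_)
    by_contra h
    apply hRH
    refine riemannHypothesis_of_weilEvenGroundEnergy_bddBelow (L := L) (a₀ := 1) fun a ha ↦ ?_
    by_contra hlt
    rw [not_le] at hlt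
    apply h
    filter_upwards [eventually_ge_atTop a] with b hb
    exact (weilEvenGroundEnergy_antitone (by linarith) hb).trans hlt.le

/-! ## §8 The parity-free energy `ε ≤ ε_ev` inherits the dictionary (sharp rate) -/

/-- **Floor-rate dictionary for `ε = weilGroundEnergy`** (sharpening the tree's
`GroundStatesConvergeToXi.abs_re_sub_half_le_of_weilGroundEnergy_ge_neg_exp`, which concludes
`≤ δ`): `-K e^{δa} ≤ ε(a)` for `a ≥ a₀` (`δ ≥ 0`) ⇒ `|Re ρ - 1/2| ≤ δ/2` for every non-trivial
zero, since `ε(a) ≤ ε_ev(a)` (`weilGroundEnergy_le_weilEvenGroundEnergy`). [folklore] -/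
theorem abs_re_sub_half_le_of_floor {K δ a₀ : ℝ} (hδ : 0 ≤ δ)
    (hL : ∀ a : ℝ, a₀ ≤ a → -(K * Real.exp (δ * a)) ≤ weilGroundEnergy a)
    {ρ : ℂ} (hρ : ρ ∈ ZetaZeros.riemannZetaNontrivialZeros) : |ρ.re - 1 / 2| ≤ δ / 2 :=
  abs_re_sub_half_le_of_even_floor_eventually hδ
    (fun a ha ↦ (hL a ha).trans (weilGroundEnergy_le_weilEvenGroundEnergy a)) hρ

/-- Quasi-RH from a floor on the parity-free energy. [folklore] -/
theorem quasiRiemannHypothesis_of_floor {K δ a₀ : ℝ} (hδ : 0 ≤ δ)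
    (hL : ∀ a : ℝ, a₀ ≤ a → -(K * Real.exp (δ * a)) ≤ weilGroundEnergy a) :
    QuasiRiemannHypothesis (1 / 2 + δ / 2) :=
  quasiRiemannHypothesis_of_even_floor hδ
    fun a ha ↦ (hL a ha).trans (weilGroundEnergy_le_weilEvenGroundEnergy a)

/-- Exponential sinking of `ε` under an off-line zero, at every rate `< 2 |Re ρ - 1/2|`. [folklore] -/
theorem weilGroundEnergy_sinks_of_offline_zero {ρ : ℂ}
    (hρ : ρ ∈ ZetaZeros.riemannZetaNontrivialZeros) {δ : ℝ} (hδ : 0 ≤ δ)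
    (hδρ : δ / 2 < |ρ.re - 1 / 2|) (K a₀ : ℝ) :
    ∃ a : ℝ, a₀ ≤ a ∧ weilGroundEnergy a < -(K * Real.exp (δ * a)) := by
  by_contra h
  push Not at h
  exact not_lt.2 (abs_re_sub_half_le_of_floor hδ h hρ) hδρ

/-- A two-parity floor (both `ε_ev` and `ε_od` obey `-K e^{δa}` for `a ≥ a₀`) is a floor on
`ε = min(ε_ev, ε_od)` and hence bounds the strip: `|Re ρ - 1/2| ≤ δ/2`. [folklore] -/
theorem abs_re_sub_half_le_of_parity_floors {K δ a₀ : ℝ} (hδ : 0 ≤ δ)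
    (hev : ∀ a : ℝ, a₀ ≤ a → -(K * Real.exp (δ * a)) ≤ weilEvenGroundEnergy a)
    (hod : ∀ a : ℝ, a₀ ≤ a → -(K * Real.exp (δ * a)) ≤ weilOddGroundEnergy a)
    {ρ : ℂ} (hρ : ρ ∈ ZetaZeros.riemannZetaNontrivialZeros) : |ρ.re - 1 / 2| ≤ δ / 2 :=
  abs_re_sub_half_le_of_floor hδ (fun a ha ↦ by
    rw [weilGroundEnergy_eq_min_even_odd]
    exact le_min (hev a ha) (hod a ha)) hρ

/-! ## §9 The served objects: rate floors on `ζ`'s even Galerkin blocks -/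

/-- **GALERKIN RATE DICTIONARY.**  If for every half-length `a ≥ a₀` (`a > 0`) and EVERY truncation `N`
the even Galerkin block of `ζ` at `(a, N)` obeys `-K e^{δa}·(v ⬝ᵥ v) ≤ v ⬝ᵥ (B v)`
(`PfPersistence.GalerkinFloorAt a ha (K e^{δa})`, `K, δ ≥ 0`), then every non-trivial zero has
`|Re ρ - 1/2| ≤ δ/2` (Galerkin floors at all `N` are continuum floors,
`PfPersistence.neg_le_weilEvenGroundEnergy_of_galerkinFloorAt`, then part 1). [folklore] -/
theorem abs_re_sub_half_le_of_galerkinRateFloor {K δ a₀ : ℝ} (hK : 0 ≤ K) (hδ : 0 ≤ δ)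
    (hfl : ∀ (a : ℝ) (ha : 0 < a), a₀ ≤ a → PfPersistence.GalerkinFloorAt a ha (K * Real.exp (δ * a)))
    {ρ : ℂ} (hρ : ρ ∈ ZetaZeros.riemannZetaNontrivialZeros) : |ρ.re - 1 / 2| ≤ δ / 2 := by
  refine abs_re_sub_half_le_of_even_floor_eventually (K := K) (a₀ := max a₀ 1) hδ (fun a ha ↦ ?_) hρ
  have ha0 : 0 < a := lt_of_lt_of_le one_pos ((le_max_right _ _).trans ha)
  exact PfPersistence.neg_le_weilEvenGroundEnergy_of_galerkinFloorAt (ha := ha0) (by positivity)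
    (hfl a ha0 ((le_max_left _ _).trans ha))

/-- **A UNIFORM Galerkin floor is already RH**: if one fixed `σ` bounds `ζ`'s even Galerkin blocks below,
`-σ·(v ⬝ᵥ v) ≤ v ⬝ᵥ (B v)`, at every half-length `a ≥ a₀` and every truncation, then RH — the floor
need not tend to `0` (compare the tree's `PfPersistence.riemannHypothesis_of_galerkinFloorSeq`, which
asks `σ_k → 0`).  RH-STRENGTH hypothesis; nobody has such a floor; no RH claim. [folklore] -/
theorem riemannHypothesis_of_galerkinFloor_uniform {σ a₀ : ℝ}
    (hfl : ∀ (a : ℝ) (ha : 0 < a), a₀ ≤ a → PfPersistence.GalerkinFloorAt a ha σ) :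
    RiemannHypothesis := by
  refine riemannHypothesis_of_weilEvenGroundEnergy_bddBelow (L := -max σ 0) (a₀ := max a₀ 1)
    fun a ha ↦ ?_
  have ha0 : 0 < a := lt_of_lt_of_le one_pos ((le_max_right _ _).trans ha)
  exact PfPersistence.neg_le_weilEvenGroundEnergy_of_galerkinFloorAt (ha := ha0) (le_max_right σ 0)
    ((hfl a ha0 ((le_max_left _ _).trans ha)).mono (le_max_left _ _))

/-- **RH ⟺ a uniform floor on `ζ`'s even Galerkin blocks at every window and truncation.** [folklore] -/
theorem riemannHypothesis_iff_galerkinFloor_uniform :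
    RiemannHypothesis ↔ ∃ σ : ℝ, ∀ (a : ℝ) (ha : 0 < a), PfPersistence.GalerkinFloorAt a ha σ := by
  refine ⟨fun hRH ↦ ⟨0, fun a ha ↦ (PfPersistence.galerkinFloorAt_iff ha le_rfl).2 ?_⟩,
    fun ⟨σ, hσ⟩ ↦ riemannHypothesis_of_galerkinFloor_uniform (a₀ := 1) fun a ha _ ↦ hσ a ha⟩
  rw [neg_zero]
  exact weilEvenGroundEnergy_nonneg_of_riemannHypothesis' hRH a

/-- **Off RH every uniform floor is breached**: if RH fails then for every `σ` and `a₀` there are a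
half-length `a ≥ a₀`, a truncation `N` and a coefficient vector `v` with
`v ⬝ᵥ (B^{ev}_{a,N} v) < -σ·(v ⬝ᵥ v)`.  (The contrapositive of the uniform-floor criterion; PROVED,
asserts nothing about `ζ`.) [folklore] -/
theorem exists_galerkin_breach_of_not_riemannHypothesis (hRH : ¬ RiemannHypothesis) (σ a₀ : ℝ) :
    ∃ (a : ℝ) (ha : 0 < a) (N : ℕ) (v : Fin (N + 1) → ℝ), a₀ ≤ a ∧
      v ⬝ᵥ (PfPersistence.zetaDatum ⟨a, N, ha⟩ *ᵥ v) < -σ * (v ⬝ᵥ v) := by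
  by_contra h
  push Not at h
  exact hRH (riemannHypothesis_of_galerkinFloor_uniform (σ := σ) (a₀ := a₀)
    fun a ha ha₀ N v ↦ h a ha N v ha₀)

/-- **Rate form of the breach**: a non-trivial zero at offset `|Re ρ - 1/2| > δ/2` (`δ ≥ 0`) forces, for
every `K ≥ 0` and `a₀`, a window `a ≥ a₀`, a truncation `N` and a vector `v` with
`v ⬝ᵥ (B^{ev}_{a,N} v) < -K e^{δa}·(v ⬝ᵥ v)`. [folklore] -/
theorem exists_galerkin_rate_breach_of_offline_zero {ρ : ℂ}
    (hρ : ρ ∈ ZetaZeros.riemannZetaNontrivialZeros) {δ : ℝ} (hδ : 0 ≤ δ)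
    (hδρ : δ / 2 < |ρ.re - 1 / 2|) {K : ℝ} (hK : 0 ≤ K) (a₀ : ℝ) :
    ∃ (a : ℝ) (ha : 0 < a) (N : ℕ) (v : Fin (N + 1) → ℝ), a₀ ≤ a ∧
      v ⬝ᵥ (PfPersistence.zetaDatum ⟨a, N, ha⟩ *ᵥ v) < -(K * Real.exp (δ * a)) * (v ⬝ᵥ v) := by
  by_contra h
  push Not at h
  exact not_lt.2 (abs_re_sub_half_le_of_galerkinRateFloor (a₀ := a₀) hK hδ
    (fun a ha ha₀ N v ↦ h a ha N v ha₀) hρ) hδρ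

/-! ## §10 The odd thermometer: rate zero, sinking off RH, dichotomy -/

/-- **`ε_od` bounded below on large windows ⇒ RH.** [folklore] -/
theorem riemannHypothesis_of_weilOddGroundEnergy_bddBelow {L a₀ : ℝ}
    (hL : ∀ a : ℝ, a₀ ≤ a → L ≤ weilOddGroundEnergy a) : RiemannHypothesis := by
  have hL' : ∀ a : ℝ, a₀ ≤ a → -(-L * Real.exp (0 * a)) ≤ weilOddGroundEnergy a := fun a ha ↦ by
    simpa using hL a ha
  refine riemannHypothesis_iff_strip_holds.2 fun s hs h0 h1 ↦ ?_
  have h := abs_re_sub_half_le_of_odd_floor_eventually le_rfl hL'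
    (ZetaZeros.riemannZetaNontrivialZeros.mem_iff'.2 ⟨hs, h0, h1⟩)
  rw [zero_div, abs_nonpos_iff] at h
  linarith

/-- **RH ⟺ `ε_od` is bounded below on `a > 0`.** [folklore] -/
theorem riemannHypothesis_iff_weilOddGroundEnergy_bddBelow :
    RiemannHypothesis ↔ ∃ L : ℝ, ∀ a : ℝ, 0 < a → L ≤ weilOddGroundEnergy a := by
  refine ⟨fun hRH ↦ ⟨0, fun a _ ↦ weilOddGroundEnergy_nonneg_of_riemannHypothesis hRH a⟩,
    fun ⟨L, hL⟩ ↦ ?_⟩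
  exact riemannHypothesis_of_weilOddGroundEnergy_bddBelow (a₀ := 1)
    fun a ha ↦ hL a (lt_of_lt_of_le one_pos ha)

/-- **RH ⟺ the odd ground energy is sub-exponential.** [folklore] -/
theorem riemannHypothesis_iff_weilOddGroundEnergy_subexp :
    RiemannHypothesis ↔ ∀ δ : ℝ, 0 < δ → ∃ K a₀ : ℝ, ∀ a : ℝ, a₀ ≤ a →
      -(K * Real.exp (δ * a)) ≤ weilOddGroundEnergy a := by
  refine ⟨fun hRH δ _ ↦ ⟨0, 0, fun a _ ↦ ?_⟩, fun h ↦ ?_⟩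
  · simpa using weilOddGroundEnergy_nonneg_of_riemannHypothesis hRH a
  · refine riemannHypothesis_iff_strip_holds.2 fun s hs h0 h1 ↦ ?_
    have hρ := ZetaZeros.riemannZetaNontrivialZeros.mem_iff'.2 ⟨hs, h0, h1⟩
    have h0' : |s.re - 1 / 2| ≤ 0 := le_of_forall_pos_le_add fun δ hδ ↦ by
      obtain ⟨K, a₀, hK⟩ := h δ hδ
      have := abs_re_sub_half_le_of_odd_floor_eventually hδ.le hK hρ
      linarith
    have := abs_nonpos_iff.1 h0'
    linarith

/-- **Exponential sinking of the odd thermometer under an off-line zero**, at every rate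
`δ < 2|Re ρ - 1/2|`. [folklore] -/
theorem weilOddGroundEnergy_sinks_of_offline_zero {ρ : ℂ}
    (hρ : ρ ∈ ZetaZeros.riemannZetaNontrivialZeros) {δ : ℝ} (hδ : 0 ≤ δ)
    (hδρ : δ / 2 < |ρ.re - 1 / 2|) (K a₀ : ℝ) :
    ∃ a : ℝ, a₀ ≤ a ∧ weilOddGroundEnergy a < -(K * Real.exp (δ * a)) := by
  by_contra h
  push Not at h
  exact not_lt.2 (abs_re_sub_half_le_of_odd_floor_eventually hδ h hρ) hδρ

/-- **DICHOTOMY for the odd thermometer**: `(∀ a, ε_od a ≥ 0)` or `ε_od → -∞`. [folklore] -/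
theorem weilOddGroundEnergy_dichotomy :
    (∀ a : ℝ, 0 ≤ weilOddGroundEnergy a) ∨ Tendsto weilOddGroundEnergy atTop atBot := by
  by_cases hRH : RiemannHypothesis
  · exact Or.inl (weilOddGroundEnergy_nonneg_of_riemannHypothesis hRH)
  · refine Or.inr (tendsto_atBot.2 fun L ↦ ?_)
    by_contra h
    apply hRH
    refine riemannHypothesis_of_weilOddGroundEnergy_bddBelow (L := L) (a₀ := 1) fun a ha ↦ ?_
    by_contra hlt
    rw [not_le] at hlt
    apply h
    filter_upwards [eventually_ge_atTop a] with b hb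
    exact (weilOddGroundEnergy_antitone (by linarith) hb).trans hlt.le

end Summit.RiemannHypothesis.RiemannHypothesis.Theorems.PfPersistenceFloorRateDichotomy

end
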